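import Mathlib
import HarnessLib
import HarnessLib.Audit
import Summits.AtomisticToContinuum.Statement

/-!
Route: ReflectionWordSkeleton

CLOSED (superseded) 2026-08-16T23:52:59Z by planner-rground-AtomisticToContinuum-Reflection-01fae9a1-0 — reason: superseded:route-AtomisticToContinuum-CollisionIsometryCLT — superseded by route-AtomisticToContinuum-CollisionIsometryCLT — note: route-repair seat (ground-failed) 2026-08-16: ground repaired at rev 4 (Assembly 17747 ground.trivial/tauto → restated 1:1, stmt-18005, gate ground ok, closes unchanged), then CLOSED AS SUPERSEDED by route-AtomisticToContinuum-CollisionIsometryCLT — census: (1) the mechanism crux DiffuseBackwardInfl. The file is kept as the record of this route; refuted decls are indexed as negative knowledge (`ledger negatives`).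

# Route ReflectionWordSkeleton — diffuse reflection words Maxwellise the kinetic flux; conservation
bookkeeping decides Euler

It suffices to show FLUX CLOSURE IN PROBABILITY BEFORE THE FIRST SHOCK, X = KineticFluxClosure ∧
CollisionalFluxClosure: under the
local Gibbs law at fixed small reduced density σ, for every classical hs-Euler solution (ρ,u,θ) on
[0,T) matched by the data at t = 0 and
every t < T, (K) the time-integrated empirical KINETIC momentum flux (N+1)⁻¹Σᵢ⟨∇χ(xᵢ),vᵢ⟩⟨vᵢ,e⟩ and
kinetic energy flux
(N+1)⁻¹Σᵢ⟨∇χ(xᵢ),vᵢ⟩|vᵢ|²/2 converge in probability to the local-Maxwellian values ∫₀ᵗ∫(ρ⟨∇χ,u⟩⟨u,e⟩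
+ ρθ⟨∇χ,e⟩) and
∫₀ᵗ∫⟨∇χ,u⟩(E + ρθ), and (C) the COLLISIONAL transfer — the sum over collision times τ ≤ t of the
jumps of the tested empirical momentum /
energy fields — converges in probability to the excess-pressure fluxes ∫₀ᵗ∫(p − ρθ)⟨∇χ,e⟩ and ∫₀ᵗ∫(p
− ρθ)⟨∇χ,u⟩, p = ρθZ(ρσ³)
(Spohn1991 I.3 (3.14)–(3.17) as statements in probability, kinetic and virial parts apart). X →
HydrodynamicLimit is exact conservation
bookkeeping — since rev 3 the route's fifth and lowest-ranked CRUX ConservationBookkeeping (D-0027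
§2.1: `closes` may assume cruxes
only), a theorem to prove; deciding theorem `closes` = modus ponens. RE-TYPE NOTE (route-repair
2026-08-16T23Z after p126922 / D-0032):
the sub-problem Statement `_root_.HydrodynamicLimit` is now the PACKING-GUARDED def (`∃ η₀ > 0`
outermost, guard `∀ t ∈ Ico 0 T, ∀ x,
ρ t x * σ ^ 3 < η₀` on the classical solution; verbatim HydroLimitInBandDim 3,
`hydroLimitInBandDim_three_iff_root`); the two
Euler-facing cruxes KineticFluxClosure (rev 1) and CollisionalFluxClosure (rev 2) carry the SAME
guard verbatim (they had the conjunct's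
old over-strength `∃ σ₀ … ∀ T ∀ solution`, covering imploding solutions that reach close packing),
the old η₀-free texts implying the
new ones; ConservationBookkeeping names the Statement decl, merges the two guarded prefixes (η₀ :=
min, σ₀ := min) and does the
bookkeeping — it IS the route's frame statement #1 `X → Statement`, crux-kind only because `closes`
assumes it (D-0027 §2.1); the
assembly-kind item Assembly is, since rev 4, the SUBSTANTIVE frame DiffuseBackwardInfluence →
DiffuseToKinetic → CollisionalFluxClosure →
Statement (the type `closes` takes once the bookkeeping is discharged inside it), replacing the
rev-3 pure-logic frame (the type of
`closes`), which `tauto` closes and the gate's ground battery flagged `ground.trivial`. Conforming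
gen-2 re-open of retired route
ReflectionWord (cards reflection-word-skeleton = spine, maxwellian-clt-collision-isometries): the
MECHANISM for K is the reflection word —
vel(Φ_t z) = L·vel(z) with L a word in collision (Householder) reflections (support
IsometricRepresentation), so over a kinetic window every
velocity is an exact isometric mixture vᵢ(t) = Σₖ Mᵢₖ vₖ(t−Δ), Σₖ MᵢₖMᵢₖᵀ = I₃; crux
DiffuseBackwardInfluence says the rows of M
delocalise N-uniformly, and the NEW crux DiffuseToKinetic (the adapted-isometry central limit step,
D → K) puts the mechanism on the
implication path: closes hD hG hC hB = hB ⟨hG hD, hC⟩ (hB : ConservationBookkeeping). Hard rods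
(finite Coxeter group,
permutation word) are the kernel where nothing delocalises (support HardRodPermutationWord).
Lean:
`Summit.AtomisticToContinuum.HydrodynamicLimit.Theses.ReflectionWordSkeleton.KineticFluxClosure ∧
Summit.AtomisticToContinuum.HydrodynamicLimit.Theses.ReflectionWordSkeleton.CollisionalFluxClosure`

## Assembly
Conservation-law bookkeeping, no physics beyond exact conservation — carried since rev 3 by the CRUX
ConservationBookkeeping :=
KineticFluxClosure ∧ CollisionalFluxClosure → _root_.HydrodynamicLimit (rank 6, Lean difficulty L,
provable-now mathematics, every
ingredient a definition or a PROVED cone fact; it is a crux only because `closes` may assume nothing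
but cruxes and its library-side
risks are real: P_N-null bad set, exact flux/jump decomposition along HardSphereFlow paths,
one-sided Leibniz), while the item Assembly :=
DiffuseBackwardInfluence → DiffuseToKinetic → CollisionalFluxClosure → _root_.HydrodynamicLimit (rev
4) is the substantive frame — the
mechanism-side cruxes imply the Statement —, a corollary of ConservationBookkeeping by modus ponens
(Sketch.lean
`assemblyFrame_of_bookkeeping`, rc 0) and the type `closes` takes when the bookkeeping is proved
inside it; the rev-3 version
(… → ConservationBookkeeping → Statement, literally the type of `closes`) was a tautology (`unfold
Assembly; tauto`) and is superseded. The bookkeeping: first merge the two packing-guarded prefixes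
of the
cruxes (η₀ := min η₀ᴷ η₀ᶜ, σ₀ := min σ₀ᴷ σ₀ᶜ, the guard being monotone in η₀ — Sketch.lean
`jointFluxClosure`, rc 0); then for smooth χ and z in the good set, t ↦ ⟨m_N(Φ_t z),e⟩ is piecewise
C¹ with derivative the kinetic
momentum-flux functional between collisions (free flight on 𝕋³, chain rule through Torus.gradient)
and jumps at the finitely many binary
collision times (IsHardSphereTrajectory.free/binary/locFinite), so ⟨m_N(t),e⟩ − ⟨m_N(0),e⟩ =
∫₀ᵗ(kinetic) + Σ(jumps) exactly;
KineticFluxClosure and CollisionalFluxClosure identify the two terms in probability with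
∫₀ᵗ∫(ρ⟨∇χ,u⟩⟨u,e⟩ + p⟨∇χ,e⟩), which equals
⟨ρu(t),χe⟩ − ⟨ρu(0),χe⟩ by the momentum equation of IsHardSphereEulerSolution integrated against χ
(torus integration by parts,
Torus.integral_partialDeriv_eq_zero_holds /
integral_inner_gradient_eq_neg_integral_mul_divergence_holds; Leibniz in t from
IsSmoothSpaceTimeOn, one-sided at 0); the t = 0 hypothesis closes the momentum field; energy
likewise (the tested energy field jumps
because energy is exchanged between spheres at different positions); the density field has no jump
term and its flux is the momentum
field tested against ∇χ, whose convergence at each s ≤ t is the momentum statement just obtained,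
integrated in s by domination through the
conserved kinetic energy (IsHardSphereTrajectory.configEnergy_eq_holds) and the t = 0 law of large
numbers; continuous χ from smooth χ by
uniform approximation (torus mollifier) with the same domination; the guard `ρσ³ < η₀` is never used
by the bookkeeping (it only
narrows the class of solutions, and keeps hsPressure on its genuine virial branch). The DECIDING
THEOREM (glue.lean, D-0027 §2.1,
CRUX-ONLY since rev 3, rc 0 in Sketch2.lean, axioms propext/Classical.choice/Quot.sound): `theorem
closes (hD : DiffuseBackwardInfluence)
(hG : DiffuseToKinetic) (hC : CollisionalFluxClosure) (hB : ConservationBookkeeping) :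
_root_.HydrodynamicLimit := hB ⟨hG hD, hC⟩` — the
mechanism crux is load-bearing (answering the gen-1 review), KineticFluxClosure stays claimable
directly, and a direct proof of it moots
hD/hG by route edit (closes := hB ⟨hK, hC⟩).

Rationale: WHY THIS LINE. Every hard-sphere collision is a Householder reflection of the velocity vector in
ℝ^(3(N+1)) (CIP1994 §4.2, SimanyiSzasz1999), so the
kinetic half of the Euler closure — isotropic kinetic stress, no kinetic heat flux — is a statement
about an exact isometric mixture with
conserved ℓ²-budget: Lindeberg's setting, with temperature the variance of a central limit theorem
and the Maxwellian its Gaussian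
(Mckean1966, CarlenCarvalhoGabetta2000, GabettaRegazzini2008, DoleraRegazzini2010 prove
Maxwellisation of Kac / Maxwell-molecule models by
exactly such CLTs over velocity-BLIND random collision trees; imported areas: CLTs for dependent
arrays, products of random reflections /
Kac walks doi:10.1090/conm/050/841092, doi:10.1214/aop/1042644708). The transplant to the
deterministic, velocity-SELECTED collision history
of hard spheres is split into its two honest halves: a finite-N, finite-window, shock-blind,
MD-measurable dynamical input
(DiffuseBackwardInfluence: the frozen-itinerary transfer rows spread over many ancestors, uniformly
in N — it fails exactly on the two
catalogued kernels of the Boltzmann-hypothesis barrier, the empty word of the ideal gas and the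
permutation word of hard rods,
BoldrighiniDobrushinSukhov1983, Spohn1991 §I.3.3) and the CLT bet itself (DiffuseToKinetic:
delocalisation suffices for the kinetic
closure despite velocity selection) — the refuter review of the gen-1 route asked for precisely this
split. Around the mechanism the route
keeps the typed flux frame (Spohn1991 (3.14)–(3.17); IrvingKirkwood1950 currents in hard-core jump
form), every item carrying the t = 0
data-matching guard that the negatives index shows is needed (EnskogAdjointDuality's unguarded crux
fell to a junk-EOS constant state),
and whose assembly (ConservationBookkeeping + `closes`) is exact microscopic conservation + torus
integration by parts (Evans2010 App. C.2; proved cone facts Torus.integral_*_holds) + time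
integration — no PDE uniqueness, no entropy, no noise. No open route (26 checked 2026-08-15T18:40Z)
uses the
isometric skeleton or a CLT; StiffCollisionalRelaxation's block-field flux items are
self-referential L² statements, ours are centred on
the Euler solution. RE-TYPE (2026-08-16, p126922 / D-0032): the conjunct is now packing-guarded;
KineticFluxClosure and
CollisionalFluxClosure were re-typed with the same guard verbatim (revs 1–2: nothing is claimed
about classical solutions that leave the
dilute-fluid chamber ρσ³ < η₀, where the spheres cannot follow and the virial EOS is junk), and the
bookkeeping became the crux
ConservationBookkeeping so that `closes` assumes cruxes only (rev 3); rev 4 (ground): the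
`tauto`-trivial Assembly became the frame
D → G → C → Statement.

RANKED CRUXES. #2 DiffuseBackwardInfluence (crux) — (cards reflection-word-skeleton W3/W4 and
maxwellian-clt crux 1, made a statement about the TRUE dynamics) For all continuous profiles there
is σ₀ such that for σ < σ₀ and every horizon Tmax there are C, c > 0 with: for every family of
flows, every t ∈ [0,Tmax], every window length τw > 0 (kinetic units: Δ_N = τw·(N+1)^(−1/3), window
[t−Δ_N, t]) and δ > 0, limsup_N P_N[defect > δ] ≤ C e^(−c τw)/δ, where P_N is the local Gibbs law,
the event is stated through the (unique, support TransferFamilyExists) frozen-itinerary transfer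
family L on [t−Δ_N, t] of the trajectory of z — L(t−Δ_N) = id, L constant on collision-free
stretches, and at each collision time τ of the pair (i,j) L τ = (pair reflection with the realised
contact normal of Φ_τ z) ∘ L τ⁻ — and defect = (N+1)⁻¹ Σᵢ maxₖ ‖(L t)ᵢₖ‖²_F (≤ 3 on the good set; =
3 for the empty word; small iff every row of the word is spread over many ancestors). [deps:
TransferFamilyExists] [difficulty: L] (why it might fail: Weight re-concentration: recollisions
inside transient clusters or collision-free channels for a positive fraction of particles keep
maxₖ‖Mᵢₖ‖² ≥ 1/4; O(φ)-rare per step, but N-uniform control under the time-t non-equilibrium law has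
no tool at fixed density.) [SimanyiSzasz1999, CIP1994, Sznitman1991, DewijnVanbeijeren2004,
doi:10.1103/physreve.85.056219, doi:10.1090/conm/050/841092]
#3 KineticFluxClosure (crux) — (kinetic half of X; the node the mechanism serves — implied by
DiffuseBackwardInfluence ∧ DiffuseToKinetic, direct proofs by any engine welcome; PACKING-GUARDED
since rev 1, guard verbatim the conjunct's) There is η₀ > 0 such that for all continuous profiles ∃
σ₀ ∀ σ < σ₀ ∀ classical hs-Euler solutions (ρ,u,θ) on [0,T) with ρ_t(x)σ³ < η₀ on [0,T) ∀ flows Φ: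
if the local Gibbs fields converge at t = 0 then for every t ∈ [0,T), smooth χ, direction e and δ >
0 the P_N-probability that |∫₀ᵗ (N+1)⁻¹Σᵢ⟨∇χ(xᵢ(s)),vᵢ(s)⟩⟨vᵢ(s),e⟩ ds − ∫₀ᵗ∫(ρ⟨∇χ,u⟩⟨u,e⟩ +
ρθ⟨∇χ,e⟩)dx ds| > δ tends to 0, and likewise for the kinetic energy flux (N+1)⁻¹Σᵢ⟨∇χ(xᵢ),vᵢ⟩|vᵢ|²/2
against ∫₀ᵗ∫⟨∇χ,u⟩(E + ρθ), E = ρ(|u|²/2 + 3θ/2): the kinetic stress is ρu⊗u + ρθ𝟙 and the kinetic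
energy flux (E + ρθ)u in time-integrated probability — local Maxwellian closure of Spohn1991
(3.16)–(3.17), kinetic part, centred on the Euler solution. [difficulty: open-problem] (why it might
fail: It is local equilibrium for deterministic spheres at fixed σ on Euler times ('so far no
proof', Spohn1991 I.3): a persistent traceless kinetic stress or kinetic heat flux for some smooth
dilute pre-shock data (packing below any η₀) falsifies it — and in substance the conjunct.)
[Spohn1991, OllaVaradhanYau1993, IrvingKirkwood1950, GabettaRegazzini2008]
#4 DiffuseToKinetic (crux) — (NEW at gen 2 — the adapted-isometry central limit step; card
maxwellian-clt crux 2 'AdaptedWeightCLT' as an implication between the route's own decls)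
DiffuseBackwardInfluence → KineticFluxClosure: N-uniform delocalisation of the frozen-itinerary
transfer rows over kinetic windows suffices for the kinetic flux closure in probability — summing
windows, vᵢ(t) = Σₖ Mᵢₖ vₖ(t−Δ_N) with diffuse, block-orthonormal weights is asymptotically centred
Gaussian around the local velocity with covariance Σₖ Mᵢₖ Cₖ Mᵢₖᵀ ≈ (tr C̄/3)𝟙, i.e. the kinetic
stress isotropises to ρθ𝟙 + ρu⊗u and the kinetic heat flux vanishes, the local parameters being
identified with the Euler fields through the conservation bookkeeping. [deps:
DiffuseBackwardInfluence, KineticFluxClosure] [difficulty: open-problem] (why it might fail: The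
word is velocity-SELECTED (rate ∝ (g·ω)₊): diffuse rows need not act on thermal velocities like an
independent isometry — a delocalised but velocity-sorted word could keep a traceless stress or
rest-frame heat current; Kac-model CLTs (McKean, Gabetta–Regazzini) use velocity-blind trees.)
[Mckean1966, GabettaRegazzini2008, CarlenCarvalhoGabetta2000, DoleraRegazzini2010, Spohn1991]
#5 CollisionalFluxClosure (crux) — (collisional half of X; card maxwellian-clt crux 3 /
reflection-word 'collisional-transfer locality'; PACKING-GUARDED since rev 2) There is η₀ > 0 such
that for all continuous profiles ∃ σ₀ ∀ σ < σ₀ ∀ classical hs-Euler solutions (ρ,u,θ) on [0,T) with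
ρ_t(x)σ³ < η₀ on [0,T) ∀ flows Φ: if the local Gibbs fields converge at t = 0 then for t ∈ [0,T),
smooth χ, direction e, δ > 0 the P_N-probability that the collisional momentum transfer Σ_(collision
times 0<τ≤t) [⟨m_N(Φ_τ z),e⟩ − ⟨m_N(Φ_τ⁻ z),e⟩] (m_N = empirical momentum field tested against χ;
Φ_τ⁻ z the pre-collisional left limit; finsum, finite on the good set) deviates by more than δ from
∫₀ᵗ∫(p − ρθ)⟨∇χ,e⟩dx ds, p = hsPressure σ ρ θ = ρθZ(ρσ³), tends to 0; likewise the energy-field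
jumps against ∫₀ᵗ∫(p − ρθ)⟨∇χ,u⟩: the collisional (virial) stress is the excess pressure ρθ(Z−1)𝟙
and the collisional energy flux (p − ρθ)u, Spohn1991 (3.15). [difficulty: open-problem] (why it
might fail: Needs the contact pair correlation along the (dilute, guarded) non-equilibrium flow to
equal its local-equilibrium value g(σ⁺;ρσ³) at leading order (Enskog-level chaos at contact);
ring/recollision-built pre-collisional correlations could shift the collisional pressure.)
[Spohn1991, VanbeijerenErnst1973, Resibois1978, IrvingKirkwood1950]
#6 ConservationBookkeeping (crux) — (NEW at rev 3: the conservation-law bookkeeping, formerly the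
text of the item Assembly, filed as the fifth and lowest-ranked crux because the deciding theorem
may assume cruxes only, D-0027 §2.1; provable-now mathematics, Lean difficulty L) KineticFluxClosure
∧ CollisionalFluxClosure → HydrodynamicLimit (the re-typed, packing-guarded Statement decl by name):
merge the guarded prefixes (η₀ := min, σ₀ := min), write ⟨field_N(t),χ⟩ − ⟨field_N(0),χ⟩ = ∫₀ᵗ
kinetic flux + Σ_(collisions ≤ t) jumps exactly along good trajectories (density: no jump, flux =
momentum field against ∇χ), identify both terms in probability by the two flux cruxes, recognise
⟨ρu(t) − ρu(0), χe⟩ and ⟨E(t) − E(0), χ⟩ through the classical Euler equations of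
IsHardSphereEulerSolution integrated against χ (torus integration by parts, one-sided Leibniz on Ico
0 T), close with the t = 0 LLN, and pass from smooth to continuous χ by mollification with N-uniform
tightness from the conserved mass and kinetic energy. [deps: KineticFluxClosure,
CollisionalFluxClosure] [difficulty: L] (why it might fail: as typed it leans on unproved library
facts — P_N-null bad set of HardSphereFlow under localGibbsLaw, the exact flux/jump decomposition of
tested empirical fields along flow paths (leftLim / ∑ᶠ / ∫ junk off the good set), one-sided Leibniz
for IsSmoothSpaceTimeOn; a gap there leaves it unprovable as stated, a misstated-class risk, never
evidence against the conjunct.) [Spohn1991, IrvingKirkwood1950, Alexander1975, Evans2010,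
OllaVaradhanYau1993]
#1 Assembly (assembly) — (rev 4) the substantive frame DiffuseBackwardInfluence → DiffuseToKinetic →
CollisionalFluxClosure → HydrodynamicLimit (mechanism-side cruxes ⟹ Statement): a one-line corollary
of #6, and the type of `closes` once the bookkeeping is discharged inside it; replaces the
`tauto`-trivial rev-3 frame. [deps: ConservationBookkeeping] [difficulty: L]
#9 IsometricRepresentation (support) — (both cards' S1/W5, any dimension d, any diameter) For every
hard-sphere flow on 𝕋ᵈ, every good z and t ≥ 0 there is a linear map L in the monoid generated by
the pair reflections w ↦ (wᵢ,wⱼ replaced by reflectVel n (wᵢ,wⱼ)), n ≠ 0, with vel(Φ_t z) = L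
vel(z): the velocity vector is moved by a WORD in collision reflections (hence isometric, momentum-
and uniform-field-preserving). Induction over the finite collision sequence of
IsHardSphereTrajectory (refuter note gen 1: the normal of the ordered pair (j,i) is ±n_ij via
`binary`, σ arbitrary). [difficulty: provable-now] [CIP1994, GST2013, SimanyiSzasz1999]
#9 HardRodPermutationWord (support) — (reflection-word Rung A kernel: equal masses in d = 1 = finite
Coxeter group A_(N−1)) For hard rods on the circle — any HardSphereFlow for Torus.geometry (Fin 1) —
and every good z and time t, the velocities at time t are a PERMUTATION of the initial velocities
(in d = 1, reflectVel n swaps the pair for n ≠ 0 and is the identity for n = 0): every Σᵢ f(vᵢ) is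
conserved, the transfer word never delocalises, and the BoltzmannHypothesis kernel (non-Euler
hard-rod limit, BoldrighiniDobrushinSukhov1983, Spohn1991 §I.3.3) sits inside the skeleton.
[difficulty: provable-now] [Spohn1991, BoldrighiniDobrushinSukhov1983, doi:10.1007/bf02181254]
#9 TransferFamilyExists (support) — (non-vacuity and well-posedness of DiffuseBackwardInfluence) For
every σ, N, flow Φ, good z and s₀ ≤ t there EXISTS a transfer family L on [s₀,t] with the three
defining clauses of DiffuseBackwardInfluence (L s₀ = id; constant on collision-free (a,b] ⊆ [s₀,t];
jump by the realised pair reflection at each collision time, composed with the left limit), it is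
UNIQUE on [s₀,t], L t is an isometry of the velocity ℓ²-budget and fixes uniform velocity fields.
Piecewise-constant construction over the finite, binary collision sequence
(IsHardSphereTrajectory.locFinite/binary); consistency of the (i,j)/(j,i) clauses is
collidePair-symmetry. [difficulty: provable-now] [GST2013, CIP1994, Alexander1975]

TWO-LAYER PLAN. DiffuseToKinetic ⇐ RotationalDiffuseness → AncestralDecorrelation → DiffuseToKinetic
(k ≤ 3, filed by `route edit --split DiffuseToKinetic`
once DiffuseBackwardInfluence is grounded/attacked or its equilibrium sub-case lands): rotational
diffuseness of the blocks Mᵢₖ/‖Mᵢₖ‖ over a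
window, pair decorrelation of ancestor thermal velocities at mean-free-path separation under the
time-(t−Δ_N) law, and the Lindeberg glue
(cubic-moment truncation against the conserved quadratic energy for the energy flux); the
identification of the local parameters with the
Euler fields is a bootstrap through ConservationBookkeeping's identities and may take
CollisionalFluxClosure as a hypothesis of the glue.
CollisionalFluxClosure ⇐ ContactRateLocality → ContactPairCorrelation → CollisionalFluxClosure
(contact statistics; shared in substance with
StiffCollisionalRelaxation.CollisionalTransferLocality and card limit-collision-measure-chaos) — not
filed now. First provable rungs foreseen
as `--supports`: DiffuseBackwardInfluence and the CLT under the INVARIANT global Gibbs law (constant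
profiles), and the stochastic
hard-sphere Kac system (velocity-selected but chaotic trees; Carlen–Carvalho–Loss, Ann. Probab.
2020, 'Kac process with hard sphere
collisions') as the analytic consistency check that the adapted CLT returns exactly the Maxwellian.

KILL CRITERIA. (i) A theorem that at some fixed σ < σ₀ a positive, N-uniform fraction of spheres
keeps undiffused backward weight after n ≫ 1 mean free
times (defect ≥ c₀ > 0 with probability ↛ 0 as τw → ∞ — e.g. a cluster-trapping lower bound) refutes
DiffuseBackwardInfluence
(substantive): the route is BROKEN at its rank-2 node; repair = pivot to the bare flux frame (drop
DiffuseBackwardInfluence and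
DiffuseToKinetic, closes hK hC hB := hB ⟨hK, hC⟩ with KineticFluxClosure a direct hypothesis) only
if KineticFluxClosure is by then served by another
engine, else close `refuted:DiffuseBackwardInfluence`. (ii) DiffuseBackwardInfluence proved but
DiffuseToKinetic refuted (a delocalised yet
non-Maxwellising velocity-selected word) kills the MECHANISM with a first-rate negative result; same
pivot-or-close rule. (iii)
¬KineticFluxClosure or ¬CollisionalFluxClosure — now necessarily through smooth DILUTE pre-shock
data (packing below every η₀), the
implosion/junk-EOS door being shut by the guard — closes the route AND is evidence against the
conjunct; file ¬HydrodynamicLimitFor σ as a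
statement then. (iii′) ¬ConservationBookkeeping cannot hold in substance (both sides are exact
conservation); a kernel `¬` would expose a
typing defect of the flux frame (junk values off the good set, a normalisation mismatch with
TendstoHydroFieldsAt) — misstated-class
repair by a repaired item, as in (iv). (iv) TransferFamilyExists refuted (clause inconsistency)
makes DiffuseBackwardInfluence vacuous
or void: misstated-class repair by a repaired item (new decl), not a kill. (v) If the adapted CLT is
shown to produce a NON-Gaussian limit
already for the stochastic hard-sphere Kac system at equilibrium, the mechanism is dead (pivot to
the bare flux frame or close). A proof of
HydrodynamicLimit by any other route moots everything.

NOT DECOMPOSED YET. The children of DiffuseToKinetic (rotational diffuseness, ancestral pair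
decorrelation at scale ℓ, Lindeberg/cubic truncation) and of
CollisionalFluxClosure (contact statistics) — layer 2, filed when DiffuseBackwardInfluence moves;
the constants C, c of
DiffuseBackwardInfluence (expected c of the order of the fresh-collision rate per kinetic unit, ∝ σ²
g(φ)√θ, not claimed); inside
ConservationBookkeeping: the piecewise-C¹ calculus of tested empirical fields along good
trajectories, joint (s,z)-measurability of the flow restricted to
the good set (right-continuous paths + measurable slices) for the Fubini/time-integration step, the
smooth → continuous χ approximation on
𝕋³, and the weak form of IsHardSphereEulerSolution against χ — prover helpers via `--supports
ConservationBookkeeping`, never items (the η₀/σ₀ merge is Sketch.lean `jointFluxClosure`). The 1-D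
bench of card
reflection-word-skeleton (Rung A: alternating-mass hard-point gas, Coxeter dichotomy finite group ⇔
μ = 1, conjectured HardPointEuler(μ)
for a.e. μ ≠ 1) is deliberately NOT filed: it cannot imply the 3-D conjunct (assembly invariant) and
needs an unequal-mass 1-D prelude the
library lacks; its equal-mass kernel IS filed (HardRodPermutationWord).

CHEAPEST FALSIFIER. Event-driven MD of DiffuseBackwardInfluence's own functional: propagate the 3×3
row blocks of the frozen-itinerary transfer matrix along a
hard-sphere run (two row updates per collision, no tangent dynamics, no binning) at φ = ρσ³ ∈ {0.05,
0.1, 0.2}, N ∈ {10³, 10⁴, 10⁵}, smooth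
non-equilibrium local Gibbs data (decaying shear/sound wave), windows of n = 1…30 mean free times;
the crux predicts defect(n) =
(N+1)⁻¹Σᵢ maxₖ‖Mᵢₖ‖²_F ≈ C e^(−cn) with N-INDEPENDENT C, c; an N-dependent plateau or a positive
floor kills it (d = 2 disks first: same
identities, cheaper). For DiffuseToKinetic at zero cost in the same run: compare the kinetic stress
anisotropy of sphere i with the
prediction Σₖ Mᵢₖ Cₖ Mᵢₖᵀ from measured block covariances — a persistent gap at diffuse rows
falsifies the CLT bet. Analytic zero-cost checks
done: defect ≡ 3 for the empty word and for hard rods (permutation word), so the functional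
separates the barrier kernels from d ≥ 2 gases;
every route decl and the crux-only `closes` elaborate (sketches rc 0, 2026-08-15/16); the rev-4
Assembly passes the full

NUMBERS. Collision rate per particle in macroscopic time ≍ 4√π g(φ) σ² √θ (N+1)^(1/3) (Enskog), so a
window Δ_N = τw (N+1)^(−1/3) holds n ≍ 4√(πθ)
σ² g(φ) τw collisions; defect ∈ [0,3] on the good set, = 3 for the empty word and for hard rods at
all t (HardRodPermutationWord);
Lagrangian displacement over a window is O((N+1)^(−1/3) τw) ≪ 1 (locality of ancestors automatic).
Kac-walk benchmarks for orientation: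
N log N random rotations to near-Haar on S^(3N−1) (Diaconis–Saloff-Coste; Porod
doi:10.1214/aop/1042644708 cut-off for random reflections)
versus (N+1)^(4/3) t reflections available per unit macroscopic time. EOS: p = ρθZ(ρσ³), Z = 1 + 4φ
g(φ), kinetic part ρθ, collisional
part ρθ(Z − 1) (Spohn1991 (3.15), virial). Items: 9 — 5 ranked cruxes (2 DiffuseBackwardInfluence, 3
KineticFluxClosure, 4 DiffuseToKinetic, 5 CollisionalFluxClosure, 6 ConservationBookkeeping),
3 supports, 1 assembly; negatives index: 17 refuted statements (2026-08-16), none touching these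
signatures.

DEFINITION REQUESTS. None at open: the transfer family is characterised inline (three clauses) in
DiffuseBackwardInfluence / TransferFamilyExists. Optional, for
grounders' comfort: a named Literature definition `velocityTransfer` (frozen-itinerary transfer as a
linear map) in
Literature/Analysis/FluidPDE; deferred bench objects `HardPointFlow` (1-D point particles with a
mass vector on 𝕋¹) and the conjecture
`HardPointEuler μ` — off the implication path, to be asked only if a definer is idle.

Novelty: Searches (2026-08-15): `lit search --hybrid "central limit theorem Maxwellian collision isometries
delocalization hard spheres local equilibrium"` (10 docs, vector leg only: Rezakhanlou–Villani 2008,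
Saint-Raymond 2009 pp. 74–78, CIP1994 — entropy/kinetic closures, nothing on isometric words); `lit
vsearch "velocities after a sequence of elastic collisions … product of orthogonal reflections …
approximately Gaussian"` (10: Longair 2003 pp. 238–243 = Maxwell's heuristic, Chapman–Cowling,
textbooks); `lit search --source crossref "central limit theorem Kac model Maxwellian collisions
probabilistic representation"` (8: GabettaRegazzini2008 doi:10.1214/08-aap524, Ariel–Vanden-Eijnden
doi:10.1088/0951-7715/22/1/008); `lit search --source crossref "products of random reflections
convergence to Haar measure orthogonal group cutoff"` (10: Collins–Śniady
doi:10.1007/s00220-006-1554-3, Malzan doi:10.4153/cjm-1982-032-9; nothing kinetic); `lit galaxy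
search "Kac walk" --star all` (8: Carlen–Carvalho–Loss 'Spectral gaps … the Kac process with hard
sphere collisions in three dimensions' pdf:-8651635351525023940, Caputo–Labbé–Lacoin
arXiv:1904.01088); `lit galaxy search "products of random reflections" / "velocities after
collisions orthogonal transformation" --star all` (0, 0); `lit frontier AtomisticToContinuum --since
2022` (30: mechanism-adjacent only arXiv:2310.13338 heat equation from deterministic dynamics and
doi:10.1007/s10955-026-03570-w fluctuations for a binary collision model)  [refs: 10.1214/08-aap524, 10.1088/0951-7715/22/1/008, 10.1007/s00220-006-1554-3, 10.4153/cjm-1982-032-9, 10.1007/s10955-026-03570-w, 10.1007/s10955-015-1331-9, 10.1103/physrevx.7.041001, 10.1214/009117906000000575, 10.1103/physreve.85.056219, 1904.01088, 2310.13338, doi:10.1214/08-aap524, doi:10.1088/0951-7715/22/1/008, doi:10.1007/s00220-006-1554-3, doi:10.4153/cjm-1982-032-9, doi:10.1007/s10955-026-035]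

Barriers (technique_class: isometric-skeleton, adapted-clt, flux-bookkeeping): - technique_class: isometric-skeleton, adapted-clt, flux-bookkeeping
- Literature.Barriers.AtomisticToContinuum.BoltzmannHypothesisBarrier: not in its technique class
(no relative-entropy method, no classification of stationary states of the infinite dynamics): the
closure input is a finite-N, finite-window property — diffuse adapted isometric weights — which
provably FAILS on the barrier's kernels (ideal gas: empty word, defect 3, and the narrowed kernel's
rest-frame heat current h_C is exactly a non-delocalised word; hard rods: permutation word,
HardRodPermutationWord), so d ≥ 2 collisions at σ > 0 are used precisely through weight splitting;
the bet (DiffuseToKinetic) is that diffuseness + a CLT replaces ergodicity for the kinetic currents.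
- Literature.Barriers.AtomisticToContinuum.HighMomentumCutoffBarrier: met only in the energy-flux
component of KineticFluxClosure (a cubic velocity moment, time-integrated, in probability);
DiffuseBackwardInfluence concerns bounded weights (defect ≤ 3) and the momentum component is
quadratic; the bet is Lindeberg truncation against the exactly conserved quadratic energy rather
than entropy bounds — it does not evade the barrier for the energy equation, it relocates it into
one named component.
- Literature.Barriers.AtomisticToContinuum.VelocityReversalBarrier: respected — every statement is
in probability under the local Gibbs law; the representation is time-symmetric (reversed word =
inverse product) while diffuseness of the influence

History (route lifecycle, newest last):
- 2026-08-16T23:27:46Z · rev 1: restated KineticFluxClosure (stmt-AtomisticToContinuum-12001) — route-repair (statement-revised p126922, D-0032: `_root_.HydrodynamicLimit` re-typed to the PACKING-GUARDED def) step 1/3: KineticFluxClosure re-typed with the (planner-rrepair-AtomisticToContinuum-Reflectio-ec8bb841-0)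
- 2026-08-16T23:31:19Z · rev 2: restated CollisionalFluxClosure (stmt-AtomisticToContinuum-12003) — route-repair (statement-revised p126922, D-0032) step 2/3: CollisionalFluxClosure re-typed with the conjunct's guard VERBATIM (`∃ η₀ > 0` outermost; `(∀ t ∈ Set (planner-rrepair-AtomisticToContinuum-Reflectio-ec8bb841-0)
- 2026-08-16T23:33:08Z · rev 3: restated Assembly (stmt-AtomisticToContinuum-12007) — route-repair (statement-revised p126922, D-0032) step 3/3 — CRUX-ONLY deciding theorem: add crux ConservationBookkeeping (rank 6) := KineticFluxClosure ∧ Collis (planner-rrepair-AtomisticToContinuum-Reflectio-ec8bb841-0)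
- 2026-08-16T23:47:46Z · rev 4: restated Assembly (stmt-AtomisticToContinuum-17747) — route-repair (ground-failed), rev 4: RESTATE Assembly (stmt-AtomisticToContinuum-17747, kind assembly, flagged ground.trivial/tauto at 23:33:21Z). Since rev 3 i (planner-rground-AtomisticToContinuum-Reflection-01fae9a1-0)
- 2026-08-16T23:52:59Z · CLOSED superseded — superseded:route-AtomisticToContinuum-CollisionIsometryCLT (planner-rground-AtomisticToContinuum-Reflection-01fae9a1-0)

sub-problem: HydrodynamicLimit · status: closed(superseded) · opened planner-plancard-AtomisticToContinuum-Hydrody-30eaa170-g2-0 2026-08-15T18:47:27Z · rev 4 · ledger route-AtomisticToContinuum-ReflectionWordSkeleton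
GENERATED by the gate from the ledger (D-0016/17). Provers cite these decls: `theorem foo : Summit.AtomisticToContinuum.HydrodynamicLimit.Theses.ReflectionWordSkeleton.<Decl> := …` in Summits/AtomisticToContinuum/HydrodynamicLimit/Theorems/<Name>.lean.
-/

namespace Summit.AtomisticToContinuum.HydrodynamicLimit.Theses.ReflectionWordSkeleton

open scoped BigOperators Topology Manifold Classical MeasureTheory ProbabilityTheory Matrix InnerProductSpace ComplexConjugate ContinuousMap
open Filter Set Function TopologicalSpace MeasureTheory

attribute [summit_statement] _root_.HydrodynamicLimit

/-- item stmt-AtomisticToContinuum-12000 · crux · rank 2 · closed · moot by None · by planner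
why it might fail: Weight re-concentration: recollisions inside transient clusters or collision-free channels for a positive fraction of particles keep maxₖ‖Mᵢₖ‖² ≥ 1/4; O(φ)-rare per step, but N-uniform control under the time-t non-equilibrium law has no tool at fixed density.
sources: SimanyiSzasz1999, CIP1994, Sznitman1991, DewijnVanbeijeren2004, doi:10.1103/physreve.85.056219, doi:10.1090/conm/050/841092
[crux] (cards reflection-word-skeleton W3/W4 and maxwellian-clt crux 1, made a statement about the
TRUE dynamics) For all continuous profiles there is σ₀ such that for σ < σ₀ and every horizon Tmax
there are C, c > 0 with: for every family of flows, every t ∈ [0,Tmax], every window length τw > 0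
(kinetic units: Δ_N = τw·(N+1)^(−1/3), window [t−Δ_N, t]) and δ > 0, limsup_N P_N[defect > δ] ≤ C
e^(−c τw)/δ, where P_N is the local Gibbs law, the event is stated through the (unique, support
TransferFamilyExists) frozen-itinerary transfer family L on [t−Δ_N, t] of the trajectory of z —
L(t−Δ_N) = id, L constant on collision-free stretches, and at each collision time τ of the pair
(i,j) L τ = (pair reflection with the realised contact normal of Φ_τ z) ∘ L τ⁻ — and defect =
(N+1)⁻¹ Σᵢ maxₖ ‖(L t)ᵢₖ‖²_F (≤ 3 on the good set; = 3 for the empty word; small iff every row of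
the word is spread over many ancestors). [deps: TransferFamilyExists] [difficulty: L] -/
@[route_item "route-AtomisticToContinuum-ReflectionWordSkeleton"]
def DiffuseBackwardInfluence : Prop :=
  ∀ (a₀ θ₀ : Literature.MathematicalPhysics.KineticTheory.T3 → ℝ) (u₀ : Literature.MathematicalPhysics.KineticTheory.T3 → Literature.MathematicalPhysics.KineticTheory.V3), Continuous a₀ → Continuous θ₀ → Continuous u₀ → (∀ x, 0 < a₀ x) → (∀ x, 0 < θ₀ x) → ∃ σ₀ : ℝ, 0 < σ₀ ∧ ∀ σ : ℝ, 0 < σ → σ < σ₀ → ∀ Tmax : ℝ, 0 < Tmax → ∃ C c : ℝ, 0 < c ∧ ∀ Φ : (N : ℕ) → Literature.Analysis.FluidPDE.HardSphereFlow (Literature.Analysis.FluidPDE.Torus.geometry (Fin 3)) (Literature.MathematicalPhysics.KineticTheory.hsDiameter σ N) (N + 1), ∀ t ∈ Set.Icc 0 Tmax, ∀ τw : ℝ, 0 < τw → ∀ δ : ℝ, 0 < δ → Filter.limsup (fun N => Literature.MathematicalPhysics.KineticTheory.localGibbsLaw σ a₀ u₀ θ₀ N (Φ N) {z | let s₀ :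 ℝ := t - τw * ((N + 1 : ℕ) : ℝ) ^ (-(1 / 3 : ℝ)); ∃ L : ℝ → (Fin (N + 1) → Literature.MathematicalPhysics.KineticTheory.V3) → (Fin (N + 1) → Literature.MathematicalPhysics.KineticTheory.V3), L s₀ = id ∧ (∀ a b : ℝ, s₀ ≤ a → a ≤ b → b ≤ t → (∀ τ ∈ Set.Ioc a b, τ ∉ Literature.Analysis.FluidPDE.collisionTimes (Literature.Analysis.FluidPDE.Torus.geometry (Fin 3)) (Literature.MathematicalPhysics.KineticTheory.hsDiameter σ N) (fun s => (Φ N).flow s z)) → L b = L a) ∧ (∀ τ : ℝ, s₀ < τ → τ ≤ t → ∀ i j : Fin (N + 1), i ≠ j → (Φ N).flow τ z ∈ Literature.Analysis.FluidPDE.contactSet (Literature.Analysis.FluidPDE.Torus.geometry (Fin 3)) (N + 1) (Literature.MathematicalPhysics.KineticTheory.hsDiameter σ N) i j → L τ = fun w k => (Literature.Analysis.FluidPDE.collidePair (Literature.Analysis.FluidPDE.Torus.geometry (Fin 3)) i j (fun m => (((Φ N).flow τ z m).1, Function.leftLim L τ w m)) k).2) ∧ δ < ((N + 1 : ℕ)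 : ℝ)⁻¹ * ∑ i : Fin (N + 1), ⨆ k : Fin (N + 1), ∑ a : Fin 3, ∑ b : Fin 3, (L t (Pi.single k (EuclideanSpace.single b (1 : ℝ))) i a) ^ 2}) Filter.atTop ≤ ENNReal.ofReal (C * Real.exp (-c * τw) / δ)

-- earlier KineticFluxClosure (stmt-AtomisticToContinuum-12001, replaced 2026-08-16T23:27:46Z -> stmt-AtomisticToContinuum-17699): retired by None — ∀ (a₀ θ₀ : Literature.MathematicalPhysics.KineticTheory.T3 → ℝ) (u₀ : Literature.MathematicalPhysics.KineticTheory.T3 → Literature.MathematicalPhysics.KineticTheory.V3), Continuous a₀ → Continuous θ₀ → Continuous u₀ → (∀ x, 0 < a₀ x) → (∀ x, 0 < θ₀ x) → 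
/-- item stmt-AtomisticToContinuum-17699 · crux · rank 3 · closed · moot by None · by planner
why it might fail: It is local equilibrium for deterministic spheres at fixed σ on Euler times ('so far no proof', Spohn1991 I.3): a persistent traceless kinetic stress or kinetic heat flux for some smooth dilute pre-shock data (packing below any η₀) falsifies it — and in substance the conjunct.
sources: Spohn1991, OllaVaradhanYau1993, IrvingKirkwood1950, GabettaRegazzini2008
[crux] (kinetic half of X; the node the mechanism serves — implied by DiffuseBackwardInfluence ∧
DiffuseToKinetic, direct proofs by any engine welcome. PACKING-GUARDED since the conjunct's re-type
D-0032 / p126922, 2026-08-16T21:32Z: `∃ η₀ > 0` outermost and the guard `∀ t ∈ Ico 0 T, ∀ x, ρ t x *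
σ ^ 3 < η₀` on the classical solution, verbatim the prefix of the re-typed Statement
`_root_.HydrodynamicLimit`; the old η₀-free text implies this one — Sketch.lean
`KineticFluxClosureR.of_unguarded`.) There is a packing threshold η₀ > 0 such that for all
continuous profiles ∃ σ₀ ∀ σ < σ₀ ∀ classical hs-Euler solutions (ρ,u,θ) on [0,T) WHOSE LOCAL
PACKING FRACTION ρ_t(x)σ³ STAYS BELOW η₀ on [0,T) ∀ flows Φ: if the local Gibbs fields converge at t
= 0 then for every t ∈ [0,T), smooth χ, direction e and δ > 0 the P_N-probability that |∫₀ᵗ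
(N+1)⁻¹Σᵢ⟨∇χ(xᵢ(s)),vᵢ(s)⟩⟨vᵢ(s),e⟩ ds − ∫₀ᵗ∫(ρ⟨∇χ,u⟩⟨u,e⟩ + ρθ⟨∇χ,e⟩)dx ds| > δ tends to 0, and
likewise for the kinetic energy flux (N+1)⁻¹Σᵢ⟨∇χ(xᵢ),vᵢ⟩|vᵢ|²/2 against ∫₀ᵗ∫⟨∇χ,u⟩(E + ρθ), E =
ρ(|u|²/2 + 3θ/2): the kinetic stress is ρu⊗u + ρθ𝟙 and the kinetic energy flux (E + ρθ)u in
time-integrated probability — local Maxwellian closure of Spohn1991 (3.16 -/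
@[route_item "route-AtomisticToContinuum-ReflectionWordSkeleton"]
def KineticFluxClosure : Prop :=
  ∃ η₀ : ℝ, 0 < η₀ ∧ ∀ (a₀ θ₀ : Literature.MathematicalPhysics.KineticTheory.T3 → ℝ) (u₀ : Literature.MathematicalPhysics.KineticTheory.T3 → Literature.MathematicalPhysics.KineticTheory.V3), Continuous a₀ → Continuous θ₀ → Continuous u₀ → (∀ x, 0 < a₀ x) → (∀ x, 0 < θ₀ x) → ∃ σ₀ : ℝ, 0 < σ₀ ∧ ∀ σ : ℝ, 0 < σ → σ < σ₀ → ∀ (T : ℝ) (ρ θ : ℝ → Literature.MathematicalPhysics.KineticTheory.T3 → ℝ) (u : ℝ → Literature.MathematicalPhysics.KineticTheory.T3 → Literature.MathematicalPhysics.KineticTheory.V3), Literature.MathematicalPhysics.KineticTheory.IsHardSphereEulerSolution σ T ρ u θ → (∀ t ∈ Set.Ico 0 T, ∀ x, ρ t x * σ ^ 3 < η₀) → ∀ Φ : (N : ℕ) → Literature.Analysis.FluidPDE.HardSphereFlow (Literature.Analysis.FluidPDE.Torus.geometry (Fin 3)) (Literature.MathematicalPhysics.KineticTheory.hsDiameter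 σ N) (N + 1), Literature.MathematicalPhysics.KineticTheory.TendstoHydroFieldsAt (fun N => Literature.MathematicalPhysics.KineticTheory.localGibbsLaw σ a₀ u₀ θ₀ N (Φ N)) Φ ρ u θ 0 → ∀ t ∈ Set.Ico 0 T, ∀ χ : Literature.MathematicalPhysics.KineticTheory.T3 → ℝ, Literature.Analysis.FunctionSpaces.Torus.IsSmooth χ → ∀ (e : Literature.MathematicalPhysics.KineticTheory.V3) (δ : ℝ), 0 < δ → Filter.Tendsto (fun N => Literature.MathematicalPhysics.KineticTheory.localGibbsLaw σ a₀ u₀ θ₀ N (Φ N) {z | δ < |(∫ s in (0:ℝ)..t, ∫ y, inner ℝ (Literature.Analysis.FunctionSpaces.Torus.gradient χ y.1) y.2 * inner ℝ y.2 e ∂(Literature.Analysis.FluidPDE.empiricalMeasure ((Φ N).flow s z))) - ∫ s in (0:ℝ)..t, ∫ x, (ρ s x * inner ℝ (Literature.Analysis.FunctionSpaces.Torus.gradient χ x) (u s x) * inner ℝ (u s x) e + ρ s x * θ s x * inner ℝ (Literature.Analysis.FunctionSpaces.Torus.gradient χ x) e)|}) Filter.atTop (nhds 0) ∧ Filter.Tendsto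 (fun N => Literature.MathematicalPhysics.KineticTheory.localGibbsLaw σ a₀ u₀ θ₀ N (Φ N) {z | δ < |(∫ s in (0:ℝ)..t, ∫ y, inner ℝ (Literature.Analysis.FunctionSpaces.Torus.gradient χ y.1) y.2 * (‖y.2‖ ^ 2 / 2) ∂(Literature.Analysis.FluidPDE.empiricalMeasure ((Φ N).flow s z))) - ∫ s in (0:ℝ)..t, ∫ x, inner ℝ (Literature.Analysis.FunctionSpaces.Torus.gradient χ x) (u s x) * (Literature.MathematicalPhysics.KineticTheory.totalEnergyDensity (ρ s x) (u s x) (θ s x) + ρ s x * θ s x)|}) Filter.atTop (nhds 0)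

/-- item stmt-AtomisticToContinuum-12002 · crux · rank 4 · closed · moot by None · by planner
why it might fail: The word is velocity-SELECTED (rate ∝ (g·ω)₊): diffuse rows need not act on thermal velocities like an independent isometry — a delocalised but velocity-sorted word could keep a traceless stress or rest-frame heat current; Kac-model CLTs (McKean, Gabetta–Regazzini) use velocity-blind trees.
sources: Mckean1966, GabettaRegazzini2008, CarlenCarvalhoGabetta2000, DoleraRegazzini2010, Spohn1991
[crux] (NEW at gen 2 — the adapted-isometry central limit step; card maxwellian-clt crux 2
'AdaptedWeightCLT' as an implication between the route's own decls) DiffuseBackwardInfluence →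
KineticFluxClosure: N-uniform delocalisation of the frozen-itinerary transfer rows over kinetic
windows suffices for the kinetic flux closure in probability — summing windows, vᵢ(t) = Σₖ Mᵢₖ
vₖ(t−Δ_N) with diffuse, block-orthonormal weights is asymptotically centred Gaussian around the
local velocity with covariance Σₖ Mᵢₖ Cₖ Mᵢₖᵀ ≈ (tr C̄/3)𝟙, i.e. the kinetic stress isotropises to
ρθ𝟙 + ρu⊗u and the kinetic heat flux vanishes, the local parameters being identified with the Euler
fields through the conservation bookkeeping. [deps: DiffuseBackwardInfluence, KineticFluxClosure]
[difficulty: open-problem] -/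
@[route_item "route-AtomisticToContinuum-ReflectionWordSkeleton"]
def DiffuseToKinetic : Prop :=
  DiffuseBackwardInfluence → KineticFluxClosure

-- earlier CollisionalFluxClosure (stmt-AtomisticToContinuum-12003, replaced 2026-08-16T23:31:19Z -> stmt-AtomisticToContinuum-17737): retired by None — ∀ (a₀ θ₀ : Literature.MathematicalPhysics.KineticTheory.T3 → ℝ) (u₀ : Literature.MathematicalPhysics.KineticTheory.T3 → Literature.MathematicalPhysics.KineticTheory.V3), Continuous a₀ → Continuous θ₀ → Continuous u₀ → (∀ x, 0 < a₀ x) → (∀ x, 0 < θ₀ x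
/-- item stmt-AtomisticToContinuum-17737 · crux · rank 5 · closed · moot by None · by planner
why it might fail: Needs the contact pair correlation along the (dilute, guarded) non-equilibrium flow to equal its local-equilibrium value g(σ⁺;ρσ³) at leading order (Enskog-level chaos at contact); ring/recollision-built pre-collisional correlations could shift the collisional pressure.
sources: Spohn1991, VanbeijerenErnst1973, Resibois1978, IrvingKirkwood1950
[crux] (collisional half of X; card maxwellian-clt crux 3 / reflection-word 'collisional-transfer
locality'. PACKING-GUARDED since the conjunct's re-type D-0032 / p126922, 2026-08-16T21:32Z: `∃ η₀ >
0` outermost and the guard `∀ t ∈ Ico 0 T, ∀ x, ρ t x * σ ^ 3 < η₀` on the classical solution,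
verbatim the prefix of the re-typed Statement; the old η₀-free text implies this one — Sketch.lean
`CollisionalFluxClosureR.of_unguarded`.) There is a packing threshold η₀ > 0 such that for all
continuous profiles ∃ σ₀ ∀ σ < σ₀ ∀ classical hs-Euler solutions (ρ,u,θ) on [0,T) whose local
packing fraction ρ_t(x)σ³ stays below η₀ on [0,T) ∀ flows Φ: if the local Gibbs fields converge at t
= 0 then for t ∈ [0,T), smooth χ, direction e, δ > 0 the P_N-probability that the collisional
momentum transfer Σ_(collision times 0<τ≤t) [⟨m_N(Φ_τ z),e⟩ − ⟨m_N(Φ_τ⁻ z),e⟩] (m_N = empirical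
momentum field tested against χ; Φ_τ⁻ z the pre-collisional left limit; finsum, finite on the good
set) deviates by more than δ from ∫₀ᵗ∫(p − ρθ)⟨∇χ,e⟩dx ds, p = hsPressure σ ρ θ = ρθZ(ρσ³), tends to
0; likewise the energy-field jumps against ∫₀ᵗ∫(p − ρθ)⟨∇χ,u⟩: the collisional (virial) stress is
the excess pressure ρθ(Z−1)𝟙 -/
@[route_item "route-AtomisticToContinuum-ReflectionWordSkeleton"]
def CollisionalFluxClosure : Prop :=
  ∃ η₀ : ℝ, 0 < η₀ ∧ ∀ (a₀ θ₀ : Literature.MathematicalPhysics.KineticTheory.T3 → ℝ) (u₀ : Literature.MathematicalPhysics.KineticTheory.T3 → Literature.MathematicalPhysics.KineticTheory.V3), Continuous a₀ → Continuous θ₀ → Continuous u₀ → (∀ x, 0 < a₀ x) → (∀ x, 0 < θ₀ x) → ∃ σ₀ : ℝ, 0 < σ₀ ∧ ∀ σ : ℝ, 0 < σ → σ < σ₀ → ∀ (T : ℝ) (ρ θ : ℝ → Literature.MathematicalPhysics.KineticTheory.T3 → ℝ) (u : ℝ → Literature.MathematicalPhysics.KineticTheory.T3 → Literature.MathematicalPhysics.KineticTheory.V3),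 Literature.MathematicalPhysics.KineticTheory.IsHardSphereEulerSolution σ T ρ u θ → (∀ t ∈ Set.Ico 0 T, ∀ x, ρ t x * σ ^ 3 < η₀) → ∀ Φ : (N : ℕ) → Literature.Analysis.FluidPDE.HardSphereFlow (Literature.Analysis.FluidPDE.Torus.geometry (Fin 3)) (Literature.MathematicalPhysics.KineticTheory.hsDiameter σ N) (N + 1), Literature.MathematicalPhysics.KineticTheory.TendstoHydroFieldsAt (fun N => Literature.MathematicalPhysics.KineticTheory.localGibbsLaw σ a₀ u₀ θ₀ N (Φ N)) Φ ρ u θ 0 → ∀ t ∈ Set.Ico 0 T, ∀ χ : Literature.MathematicalPhysics.KineticTheory.T3 → ℝ, Literature.Analysis.FunctionSpaces.Torus.IsSmooth χ → ∀ (e : Literature.MathematicalPhysics.KineticTheory.V3) (δ : ℝ), 0 < δ → Filter.Tendsto (fun N => Literature.MathematicalPhysics.KineticTheory.localGibbsLaw σ a₀ u₀ θ₀ N (Φ N) {z | δ < |(∑ᶠ τ ∈ {τ : ℝ | τ ∈ Literature.Analysis.FluidPDE.collisionTimes (Literature.Analysis.FluidPDE.Torus.geometry (Fin 3)) (Literature.MathematicalPhysics.KineticTheory.hsDiameter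 σ N) (fun s => (Φ N).flow s z) ∧ 0 < τ ∧ τ ≤ t}, (inner ℝ (Literature.MathematicalPhysics.KineticTheory.empiricalMomentumField ((Φ N).flow τ z) χ) e - inner ℝ (Literature.MathematicalPhysics.KineticTheory.empiricalMomentumField (Function.leftLim (fun s => (Φ N).flow s z) τ) χ) e)) - ∫ s in (0:ℝ)..t, ∫ x, (Literature.MathematicalPhysics.KineticTheory.hsPressure σ (ρ s x) (θ s x) - ρ s x * θ s x) * inner ℝ (Literature.Analysis.FunctionSpaces.Torus.gradient χ x) e|}) Filter.atTop (nhds 0) ∧ Filter.Tendsto (fun N => Literature.MathematicalPhysics.KineticTheory.localGibbsLaw σ a₀ u₀ θ₀ N (Φ N) {z | δ < |(∑ᶠ τ ∈ {τ : ℝ | τ ∈ Literature.Analysis.FluidPDE.collisionTimes (Literature.Analysis.FluidPDE.Torus.geometry (Fin 3)) (Literature.MathematicalPhysics.KineticTheory.hsDiameter σ N) (fun s => (Φ N).flow s z) ∧ 0 < τ ∧ τ ≤ t}, (Literature.MathematicalPhysics.KineticTheory.empiricalEnergyField ((Φ N).flow τ z) χ - Literature.MathematicalPhysics.KineticTheory.empiricalEnergyField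 (Function.leftLim (fun s => (Φ N).flow s z) τ) χ)) - ∫ s in (0:ℝ)..t, ∫ x, (Literature.MathematicalPhysics.KineticTheory.hsPressure σ (ρ s x) (θ s x) - ρ s x * θ s x) * inner ℝ (Literature.Analysis.FunctionSpaces.Torus.gradient χ x) (u s x)|}) Filter.atTop (nhds 0)

/-- item stmt-AtomisticToContinuum-17748 · crux · rank 6 · closed · moot by None · by planner
why it might fail: As typed it leans on unproved library facts: P_N-null bad set of HardSphereFlow under localGibbsLaw, exact flux/jump decomposition of tested empirical fields along flow paths (leftLim/∑ᶠ/∫ junk off the good set), one-sided Leibniz for IsSmoothSpaceTimeOn; a gap there leaves it unprovable as stated.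
sources: Spohn1991, IrvingKirkwood1950, Alexander1975, Evans2010, OllaVaradhanYau1993
[crux] (NEW at rev 3 — the conservation-law bookkeeping, formerly the text of the item Assembly
(stmt-AtomisticToContinuum-12007, curried form), filed as the route's fifth and lowest-ranked crux
because the deciding theorem may assume cruxes only (D-0027 §2.1 crux-only rule); provable-now
mathematics, Lean difficulty L; both hypotheses are the PACKING-GUARDED cruxes of revs 1–2 and the
conclusion is the re-typed, packing-guarded sub-problem Statement decl `_root_.HydrodynamicLimit` BY
NAME.) KineticFluxClosure ∧ CollisionalFluxClosure → HydrodynamicLimit: merge the two guarded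
prefixes (η₀ := min η₀ᴷ η₀ᶜ, σ₀ := min σ₀ᴷ σ₀ᶜ; the guard ρ_t(x)σ³ < η₀ is monotone in η₀ —
Sketch.lean `jointFluxClosure`, rc 0) and never use the guard again; then for smooth χ and good z
write ⟨field_N(Φ_t z),χ⟩ − ⟨field_N(z),χ⟩ = ∫₀ᵗ (kinetic flux) ds + Σ_(collision times ≤ t) jumps
EXACTLY (free flight on 𝕋³ + binary collisions at locally finitely many times,
IsHardSphereTrajectory.free/binary/locFinite; the density field has no jump and its flux is the
momentum field against ∇χ), identify the two terms in probability by KineticFluxClosure and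
CollisionalFluxClosure with ∫₀ᵗ∫(ρ⟨∇χ,u⟩⟨u,e⟩ + p⟨∇χ,e⟩) resp -/
@[route_item "route-AtomisticToContinuum-ReflectionWordSkeleton"]
def ConservationBookkeeping : Prop :=
  KineticFluxClosure ∧ CollisionalFluxClosure → _root_.HydrodynamicLimit

/-- item stmt-AtomisticToContinuum-12004 · support · rank 9 · closed · moot by None · by planner
sources: CIP1994, GST2013, SimanyiSzasz1999
[support] (both cards' S1/W5, any dimension d, any diameter) For every hard-sphere flow on 𝕋ᵈ, every
good z and t ≥ 0 there is a linear map L in the monoid generated by the pair reflections w ↦ (wᵢ,wⱼ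
replaced by reflectVel n (wᵢ,wⱼ)), n ≠ 0, with vel(Φ_t z) = L vel(z): the velocity vector is moved
by a WORD in collision reflections (hence isometric, momentum- and uniform-field-preserving).
Induction over the finite collision sequence of IsHardSphereTrajectory (refuter note gen 1: the
normal of the ordered pair (j,i) is ±n_ij via `binary`, σ arbitrary). [difficulty: provable-now] -/
@[route_item "route-AtomisticToContinuum-ReflectionWordSkeleton"]
def IsometricRepresentation : Prop :=
  ∀ (d N : ℕ) (ε : ℝ) (Φ : Literature.Analysis.FluidPDE.HardSphereFlow (Literature.Analysis.FluidPDE.Torus.geometry (Fin d)) ε N), ∀ z ∈ Φ.good, ∀ t : ℝ, 0 ≤ t → ∃ L : Module.End ℝ (Fin N → EuclideanSpace ℝ (Fin d)), L ∈ Submonoid.closure {M : Module.End ℝ (Fin N → EuclideanSpace ℝ (Fin d)) | ∃ i j : Fin N, i ≠ j ∧ ∃ n : EuclideanSpace ℝ (Fin d), n ≠ 0 ∧ ∀ w : Fin N → EuclideanSpace ℝ (Fin d), M w = Function.update (Function.update w i (Literature.Analysis.FluidPDE.reflectVel n (w i, w j)).1) j (Literature.Analysis.FluidPDE.reflectVel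 n (w i, w j)).2} ∧ (fun i => (Φ.flow t z i).2) = L (fun i => (z i).2)

/-- item stmt-AtomisticToContinuum-12005 · support · rank 9 · closed · moot by None · by planner
sources: Spohn1991, BoldrighiniDobrushinSukhov1983, doi:10.1007/bf02181254
[support] (reflection-word Rung A kernel: equal masses in d = 1 = finite Coxeter group A_(N−1)) For
hard rods on the circle — any HardSphereFlow for Torus.geometry (Fin 1) — and every good z and time
t, the velocities at time t are a PERMUTATION of the initial velocities (in d = 1, reflectVel n
swaps the pair for n ≠ 0 and is the identity for n = 0): every Σᵢ f(vᵢ) is conserved, the transfer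
word never delocalises, and the BoltzmannHypothesis kernel (non-Euler hard-rod limit,
BoldrighiniDobrushinSukhov1983, Spohn1991 §I.3.3) sits inside the skeleton. [difficulty:
provable-now] -/
@[route_item "route-AtomisticToContinuum-ReflectionWordSkeleton"]
def HardRodPermutationWord : Prop :=
  ∀ (N : ℕ) (ε : ℝ) (Φ : Literature.Analysis.FluidPDE.HardSphereFlow (Literature.Analysis.FluidPDE.Torus.geometry (Fin 1)) ε N), ∀ z ∈ Φ.good, ∀ t : ℝ, ∃ π : Equiv.Perm (Fin N), ∀ i : Fin N, (Φ.flow t z i).2 = (z (π i)).2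

/-- item stmt-AtomisticToContinuum-12006 · support · rank 9 · closed · moot by None · by planner
sources: GST2013, CIP1994, Alexander1975
[support] (non-vacuity and well-posedness of DiffuseBackwardInfluence) For every σ, N, flow Φ, good
z and s₀ ≤ t there EXISTS a transfer family L on [s₀,t] with the three defining clauses of
DiffuseBackwardInfluence (L s₀ = id; constant on collision-free (a,b] ⊆ [s₀,t]; jump by the realised
pair reflection at each collision time, composed with the left limit), it is UNIQUE on [s₀,t], L t
is an isometry of the velocity ℓ²-budget and fixes uniform velocity fields. Piecewise-constant
construction over the finite, binary collision sequence (IsHardSphereTrajectory.locFinite/binary);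
consistency of the (i,j)/(j,i) clauses is collidePair-symmetry. [difficulty: provable-now] -/
@[route_item "route-AtomisticToContinuum-ReflectionWordSkeleton"]
def TransferFamilyExists : Prop :=
  ∀ (σ : ℝ) (N : ℕ) (Φ : Literature.Analysis.FluidPDE.HardSphereFlow (Literature.Analysis.FluidPDE.Torus.geometry (Fin 3)) (Literature.MathematicalPhysics.KineticTheory.hsDiameter σ N) (N + 1)), ∀ z ∈ Φ.good, ∀ s₀ t : ℝ, s₀ ≤ t → ∃ L : ℝ → (Fin (N + 1) → Literature.MathematicalPhysics.KineticTheory.V3) → (Fin (N + 1) → Literature.MathematicalPhysics.KineticTheory.V3), (L s₀ = id ∧ (∀ a b : ℝ, s₀ ≤ a → a ≤ b → b ≤ t → (∀ τ ∈ Set.Ioc a b, τ ∉ Literature.Analysis.FluidPDE.collisionTimes (Literature.Analysis.FluidPDE.Torus.geometry (Fin 3)) (Literature.MathematicalPhysics.KineticTheory.hsDiameter σ N) (fun s => Φ.flow s z)) → L b = L a) ∧ (∀ τ : ℝ, s₀ < τ → τ ≤ t → ∀ i j : Fin (N + 1), i ≠ j → Φ.flow τ z ∈ Literature.Analysis.FluidPDE.contactSet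 (Literature.Analysis.FluidPDE.Torus.geometry (Fin 3)) (N + 1) (Literature.MathematicalPhysics.KineticTheory.hsDiameter σ N) i j → L τ = fun w k => (Literature.Analysis.FluidPDE.collidePair (Literature.Analysis.FluidPDE.Torus.geometry (Fin 3)) i j (fun m => ((Φ.flow τ z m).1, Function.leftLim L τ w m)) k).2)) ∧ (∀ L' : ℝ → (Fin (N + 1) → Literature.MathematicalPhysics.KineticTheory.V3) → (Fin (N + 1) → Literature.MathematicalPhysics.KineticTheory.V3), (L' s₀ = id ∧ (∀ a b : ℝ, s₀ ≤ a → a ≤ b → b ≤ t → (∀ τ ∈ Set.Ioc a b, τ ∉ Literature.Analysis.FluidPDE.collisionTimes (Literature.Analysis.FluidPDE.Torus.geometry (Fin 3)) (Literature.MathematicalPhysics.KineticTheory.hsDiameter σ N) (fun s => Φ.flow s z)) → L' b = L' a) ∧ (∀ τ : ℝ, s₀ < τ → τ ≤ t → ∀ i j : Fin (N + 1), i ≠ j → Φ.flow τ z ∈ Literature.Analysis.FluidPDE.contactSet (Literature.Analysis.FluidPDE.Torus.geometry (Fin 3)) (N + 1) (Literature.MathematicalPhysics.KineticTheory.hsDiameter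 σ N) i j → L' τ = fun w k => (Literature.Analysis.FluidPDE.collidePair (Literature.Analysis.FluidPDE.Torus.geometry (Fin 3)) i j (fun m => ((Φ.flow τ z m).1, Function.leftLim L' τ w m)) k).2)) → ∀ τ ∈ Set.Icc s₀ t, L' τ = L τ) ∧ (∀ w, ∑ i, ‖L t w i‖ ^ 2 = ∑ i, ‖w i‖ ^ 2) ∧ (∀ v : Literature.MathematicalPhysics.KineticTheory.V3, L t (fun _ => v) = fun _ => v)

-- earlier Assembly (stmt-AtomisticToContinuum-12007, replaced 2026-08-16T23:33:08Z -> stmt-AtomisticToContinuum-17747): retired by None — KineticFluxClosure → CollisionalFluxClosure → _root_.HydrodynamicLimit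
-- earlier Assembly (stmt-AtomisticToContinuum-17747, replaced 2026-08-16T23:47:46Z -> stmt-AtomisticToContinuum-18005): retired by None — DiffuseBackwardInfluence → DiffuseToKinetic → CollisionalFluxClosure → ConservationBookkeeping → _root_.HydrodynamicLimit
/-- item stmt-AtomisticToContinuum-18005 · assembly · rank 1 · closed · moot by None · by planner
sources: Spohn1991, IrvingKirkwood1950, Evans2010
[assembly] (rev 4, ground repair — the SUBSTANTIVE frame, replacing the rev-3 pure-logic frame)
DiffuseBackwardInfluence → DiffuseToKinetic → CollisionalFluxClosure → HydrodynamicLimit: the three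
mechanism-side cruxes (ranks 2, 4, 5) imply the re-typed, packing-guarded sub-problem Statement decl
`_root_.HydrodynamicLimit` by name. Its content is exactly the conservation bookkeeping of crux #6:
it follows from ConservationBookkeeping by modus ponens, `fun hB hD hG hC => hB ⟨hG hD, hC⟩`
(planner Sketch.lean `assemblyFrame_of_bookkeeping`, rc 0 remote farm 2026-08-16), so a prover
closes it as a one-line corollary the moment ConservationBookkeeping lands, and it is the type the
deciding theorem `closes` takes once that bookkeeping hypothesis is discharged inside the proof
(D-0027 backfill: `closes hD hG hC := conservationBookkeeping_holds ⟨hG hD, hC⟩`). Why restated: the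
rev-3 text DiffuseBackwardInfluence → DiffuseToKinetic → CollisionalFluxClosure →
ConservationBookkeeping → HydrodynamicLimit was literally the type of `closes` and is a tautology
once the two implication-shaped cruxes unfold (`unfold Assembly; tauto`, reproduced in Sketch.lean)
— the gate's ground battery flagged it -/
@[route_item "route-AtomisticToContinuum-ReflectionWordSkeleton"]
def Assembly : Prop :=
  DiffuseBackwardInfluence → DiffuseToKinetic → CollisionalFluxClosure → _root_.HydrodynamicLimit

end Summit.AtomisticToContinuum.HydrodynamicLimit.Theses.ReflectionWordSkeleton
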